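import Summits.NavierStokesRegularity.NavierStokesRegularity.Theses.SymmetryModuliCount
import Literature.Analysis.FluidPDE.BurgersVortexLayerSteady

/-!
# `FiniteTangentModuliMild`, negative side: the Kolmogorov-shear witness of p73226 (construction)

Support file for `FalseWithoutMild.lean` (crux stmt-NavierStokesRegularity-14049, cdisprove seat): the
decaying Kolmogorov shear `u = (1-t)⁻¹ sin(x₀) e₁` and its dressed parasitic modes
`v_k = a^{k+2} cos(x₀) e₁ + B_k(t) e₀`, `q_k = -B_k'(t) x₀` (`a = (1-t)⁻¹`,
`B_k = -((k+2)a^{k+2} + a^{k+1})`), with their calculus: time and space derivatives, `div = 0`, the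
linearised momentum equation `∂ₜv_k + (u·∇)v_k + (v_k·∇)u = Δv_k - ∇q_k`, joint smoothness on
`t < 0`.  Verbatim the construction of the refutation p73226 of the rev-1 crux `FiniteTangentModuli`
(`Theorems/SymmetryModuliCountFiniteTangentModuliRefutation.lean`, where it is `private`), made
public in namespace `KolmogorovCex`.  Growth bounds and independence: `KolmogorovModesBounds.lean`.

## References

* G. Koch, N. Nadirashvili, G. Seregin, V. Šverák, Acta Math. 203 (2009), §1 p. 3 (parasitic
  solutions `b(t)`, `-b'(t)·x`). [KNSS2009]
-/

noncomputable section

open Set Function Filter Topology WithLp MeasureTheory InnerProductSpace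
open scoped Laplacian RealInnerProductSpace ContDiff BigOperators

set_option linter.dupNamespace false

namespace Summit.NavierStokesRegularity.NavierStokesRegularity.Theorems.FiniteTangentModuliMild.Negative

open Literature.Analysis Literature.Analysis.FluidPDE Literature.Analysis.FluidPDE.StrainedShear

/-- Local notation for physical space `ℝ³ = EuclideanSpace ℝ (Fin 3)`. -/
local notation "ℝ³" => EuclideanSpace ℝ (Fin 3)

namespace KolmogorovCex

/-- `e₀ = (1, 0, 0)`: the direction along which the drift varies (the forced parasitic direction). -/
def eZero : ℝ³ := EuclideanSpace.single 0 1

/-- Components of `e₀`. [folklore] -/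
@[simp] theorem eZero_apply_zero : eZero 0 = 1 := by simp [eZero]
/-- Components of `e₀`. [folklore] -/
@[simp] theorem eZero_apply_one : eZero 1 = 0 := by simp [eZero]

/-- `‖e₀‖ = 1`. [folklore] -/
@[simp] theorem norm_eZero : ‖eZero‖ = 1 := by simp [eZero]
/-- `‖e₁‖ = 1`. [folklore] -/
@[simp] theorem norm_eOne : ‖eOne‖ = 1 := by simp [eOne]

/-- The drift amplitude `a(t) = (1 - t)⁻¹`. -/
def amp (t : ℝ) : ℝ := (1 - t)⁻¹

/-- The drift `u(t, x) = a(t) sin(x₀) e₁` (a decaying Kolmogorov shear flow). -/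
def drift (t : ℝ) : ℝ³ → ℝ³ := shear (fun s => amp t * Real.sin s)

/-- The parasitic amplitude `B_k(t) = -((k+2) a^{k+2} + a^{k+1})` of the `k`-th mode. -/
def bee (k : ℕ) (t : ℝ) : ℝ := -(((k : ℝ) + 2) * amp t ^ (k + 2) + amp t ^ (k + 1))

/-- `Q_k(t) = -B_k'(t) = (k+2)² a^{k+3} + (k+1) a^{k+2}`. -/
def cue (k : ℕ) (t : ℝ) : ℝ := ((k : ℝ) + 2) ^ 2 * amp t ^ (k + 3) + ((k : ℝ) + 1) * amp t ^ (k + 2)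

/-- The `k`-th mode `v_k(t, x) = a(t)^{k+2} cos(x₀) e₁ + B_k(t) e₀`. -/
def mode (k : ℕ) (t : ℝ) (x : ℝ³) : ℝ³ :=
  shear (fun s => amp t ^ (k + 2) * Real.cos s) x + bee k t • eZero

/-- The `k`-th pressure `q_k(t, x) = Q_k(t) x₀ = -B_k'(t) x₀`. -/
def modePressure (k : ℕ) (t : ℝ) (x : ℝ³) : ℝ := ⟪cue k t • eZero, x⟫

/-! ### Elementary bounds on the amplitude -/

/-- `1 - t > 0` for `t < 0`. [folklore] -/
theorem one_sub_pos_of_neg {t : ℝ} (ht : t < 0) : 0 < 1 - t := by linarith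

/-- `a(t) > 0` for `t < 0`. [folklore] -/
theorem amp_pos {t : ℝ} (ht : t < 0) : 0 < amp t := inv_pos.2 (one_sub_pos_of_neg ht)

/-- `a(t) ≥ 0` for `t < 0`. [folklore] -/
theorem amp_nonneg {t : ℝ} (ht : t < 0) : 0 ≤ amp t := (amp_pos ht).le

/-- `a(t) ≤ 1` for `t < 0`. [folklore] -/
theorem amp_le_one {t : ℝ} (ht : t < 0) : amp t ≤ 1 :=
  inv_le_one_of_one_le₀ (by linarith)

/-- `a(t) ≤ 1/(-t)` for `t < 0` (`-t ≤ 1 - t`). [folklore] -/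
theorem amp_le_inv {t : ℝ} (ht : t < 0) : amp t ≤ 1 / (-t) := by
  rw [one_div]
  exact inv_anti₀ (by linarith) (by linarith)

/-- `√(-t) ≤ 1 - t` for `t < 0` (AM–GM: `2√s ≤ 1 + s`). [folklore] -/
theorem sqrt_le_one_sub {t : ℝ} (ht : t < 0) : Real.sqrt (-t) ≤ 1 - t := by
  have hs : 0 ≤ Real.sqrt (-t) := Real.sqrt_nonneg _
  have hsq : Real.sqrt (-t) ^ 2 = -t := Real.sq_sqrt (by linarith)
  nlinarith [sq_nonneg (Real.sqrt (-t) - 1)]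

/-- `a(t) ≤ 1/√(-t)` for `t < 0`: the Type-I rate of the drift. [folklore] -/
theorem amp_le_inv_sqrt {t : ℝ} (ht : t < 0) : amp t ≤ 1 / Real.sqrt (-t) := by
  rw [one_div]
  exact inv_anti₀ (Real.sqrt_pos.2 (by linarith)) (sqrt_le_one_sub ht)

/-- `a(t)² ≤ 1/√(-t)³` for `t < 0`: the pressure rate. [folklore] -/
theorem amp_sq_le {t : ℝ} (ht : t < 0) : amp t ^ 2 ≤ 1 / Real.sqrt (-t) ^ 3 := by
  have hs : 0 < Real.sqrt (-t) := Real.sqrt_pos.2 (by linarith)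
  have hsq : Real.sqrt (-t) ^ 2 = -t := Real.sq_sqrt (by linarith)
  have h1 := amp_le_inv_sqrt ht
  have h2 := amp_le_inv ht
  have h3 : amp t ^ 2 ≤ 1 / Real.sqrt (-t) * (1 / (-t)) := by
    rw [sq]
    exact mul_le_mul h1 h2 (amp_nonneg ht) (by positivity)
  refine h3.trans (le_of_eq ?_)
  rw [pow_succ, hsq]
  field_simp

/-- Powers of `a(t) ∈ (0, 1]` are at most `a(t)`. [folklore] -/
theorem amp_pow_succ_le {t : ℝ} (ht : t < 0) (n : ℕ) : amp t ^ (n + 1) ≤ amp t :=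
  pow_le_of_le_one (amp_nonneg ht) (amp_le_one ht) (Nat.succ_ne_zero n)

/-- Powers `a(t)^{n+2} ≤ a(t)²`. [folklore] -/
theorem amp_pow_le_sq {t : ℝ} (ht : t < 0) (n : ℕ) : amp t ^ (n + 2) ≤ amp t ^ 2 :=
  pow_le_pow_of_le_one (amp_nonneg ht) (amp_le_one ht) (by omega)

/-! ### Time derivatives -/

/-- `a'(t) = a(t)²`. [folklore] -/
theorem hasDerivAt_amp {t : ℝ} (ht : t < 0) : HasDerivAt amp (amp t ^ 2) t := by
  have h1 : HasDerivAt (fun s : ℝ => 1 - s) (-1) t := by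
    simpa using (hasDerivAt_id t).const_sub 1
  have h2 := h1.fun_inv (one_sub_pos_of_neg ht).ne'
  refine h2.congr_deriv ?_
  simp [amp, inv_pow]

/-- `(aⁿ)'(t) = n a(t)^{n+1}`. [folklore] -/
theorem hasDerivAt_amp_pow {t : ℝ} (ht : t < 0) (n : ℕ) :
    HasDerivAt (fun s => amp s ^ n) ((n : ℝ) * amp t ^ (n + 1)) t := by
  refine ((hasDerivAt_amp ht).fun_pow n).congr_deriv ?_
  rcases n with _ | n
  · simp
  · rw [Nat.add_sub_cancel]
    push_cast
    ring

/-- `B_k' = -Q_k`. [folklore] -/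
theorem hasDerivAt_bee {t : ℝ} (ht : t < 0) (k : ℕ) : HasDerivAt (bee k) (-cue k t) t := by
  have ha := hasDerivAt_amp_pow ht (k + 2)
  have hb := hasDerivAt_amp_pow ht (k + 1)
  refine (((ha.const_mul ((k : ℝ) + 2)).add hb).fun_neg).congr_deriv ?_
  simp only [cue]
  push_cast
  ring

/-- The time derivative of the `k`-th mode at a fixed point. [folklore] -/
theorem hasDerivAt_mode {t : ℝ} (ht : t < 0) (k : ℕ) (x : ℝ³) :
    HasDerivAt (fun s => mode k s x)
      ((((k : ℝ) + 2) * amp t ^ (k + 3) * Real.cos (x 0)) • eOne + (-cue k t) • eZero) t := by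
  have h1 : HasDerivAt (fun s => amp s ^ (k + 2) * Real.cos (x 0))
      (((k : ℝ) + 2) * amp t ^ (k + 3) * Real.cos (x 0)) t := by
    refine ((hasDerivAt_amp_pow ht (k + 2)).mul_const (Real.cos (x 0))).congr_deriv ?_
    push_cast
    ring
  exact (h1.smul_const eOne).add ((hasDerivAt_bee ht k).smul_const eZero)

/-- `∂ₜ v_k = (k+2) a^{k+3} cos(x₀) e₁ - Q_k e₀`. [folklore] -/
theorem timeDeriv_mode {t : ℝ} (ht : t < 0) (k : ℕ) (x : ℝ³) :
    timeDeriv (mode k) t x =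
      (((k : ℝ) + 2) * amp t ^ (k + 3) * Real.cos (x 0)) • eOne + (-cue k t) • eZero :=
  (hasDerivAt_mode ht k x).deriv

/-! ### Spatial calculus -/

/-- `(c sin)' = c cos`. [folklore] -/
theorem hasDerivAt_sinProfile (c s : ℝ) :
    HasDerivAt (fun s => c * Real.sin s) (c * Real.cos s) s :=
  (Real.hasDerivAt_sin s).const_mul c

/-- `(c cos)' = -c sin`. [folklore] -/
theorem hasDerivAt_cosProfile (c s : ℝ) :
    HasDerivAt (fun s => c * Real.cos s) (c * -Real.sin s) s :=
  (Real.hasDerivAt_cos s).const_mul c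

/-- `(-c sin)' = -c cos`. [folklore] -/
theorem hasDerivAt_cosProfile' (c s : ℝ) :
    HasDerivAt (fun s => c * -Real.sin s) (c * -Real.cos s) s :=
  (Real.hasDerivAt_sin s).neg.const_mul c

/-- `D u(t)(x) h = (a(t) cos(x₀) h₀) e₁`. -/
theorem fderiv_drift_apply (t : ℝ) (x h : ℝ³) :
    fderiv ℝ (drift t) x h = (amp t * Real.cos (x 0) * h 0) • eOne :=
  fderiv_shear_apply (hasDerivAt_sinProfile (amp t)) x h

/-- `D v_k(t)(x) = (-a^{k+2} sin(x₀)) dx₀ ⊗ e₁` (the constant `B_k e₀` drops out). [folklore] -/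
theorem hasFDerivAt_mode (k : ℕ) (t : ℝ) (x : ℝ³) :
    HasFDerivAt (mode k t)
      (((amp t ^ (k + 2) * -Real.sin (x 0)) • (EuclideanSpace.proj 0 : ℝ³ →L[ℝ] ℝ)).smulRight eOne)
      x :=
  (hasFDerivAt_shear (hasDerivAt_cosProfile (amp t ^ (k + 2))) x).add_const _

/-- `D v_k(t)(x) h = (-a^{k+2} sin(x₀) h₀) e₁`. [folklore] -/
theorem fderiv_mode_apply (k : ℕ) (t : ℝ) (x h : ℝ³) :
    fderiv ℝ (mode k t) x h = (amp t ^ (k + 2) * -Real.sin (x 0) * h 0) • eOne := by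
  rw [(hasFDerivAt_mode k t x).fderiv]
  simp

/-- The drift has no `e₀`-component. [folklore] -/
theorem drift_apply_zero (t : ℝ) (x : ℝ³) : drift t x 0 = 0 := by
  simp [drift, shear]

/-- The `e₀`-component of the `k`-th mode is `B_k(t)`. [folklore] -/
theorem mode_apply_zero (k : ℕ) (t : ℝ) (x : ℝ³) : mode k t x 0 = bee k t := by
  simp [mode, shear]

/-- The `e₁`-component of the `k`-th mode is `a^{k+2} cos(x₀)`. [folklore] -/
theorem mode_apply_one (k : ℕ) (t : ℝ) (x : ℝ³) :
    mode k t x 1 = amp t ^ (k + 2) * Real.cos (x 0) := by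
  simp [mode, shear]

/-- `(u·∇)v_k = 0`: the drift points along `e₁`, the mode varies only in `x₀`. [folklore] -/
theorem convect_drift_mode (k : ℕ) (t : ℝ) (x : ℝ³) : convect (drift t) (mode k t) x = 0 := by
  rw [convect_apply, fderiv_mode_apply, drift_apply_zero]
  simp

/-- `(v_k·∇)u = (a cos(x₀) B_k) e₁`: only the parasitic part `B_k e₀` of the mode transports the drift. [folklore] -/
theorem convect_mode_drift (k : ℕ) (t : ℝ) (x : ℝ³) :
    convect (mode k t) (drift t) x = (amp t * Real.cos (x 0) * bee k t) • eOne := by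
  rw [convect_apply, fderiv_drift_apply, mode_apply_zero]

/-- `Δ v_k = -a^{k+2} cos(x₀) e₁`. [folklore] -/
theorem laplacian_mode (k : ℕ) (t : ℝ) (x : ℝ³) :
    Δ (mode k t) x = (amp t ^ (k + 2) * -Real.cos (x 0)) • eOne := by
  have hV2 : ContDiff ℝ 2 (fun s => amp t ^ (k + 2) * Real.cos s) :=
    contDiff_const.mul Real.contDiff_cos
  have hmode : mode k t = shear (fun s => amp t ^ (k + 2) * Real.cos s) + fun _ => bee k t • eZero := by
    funext y; rfl
  rw [hmode, ContDiffAt.laplacian_add ((contDiff_shear hV2).contDiffAt) contDiffAt_const,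
    laplacian_shear hV2 (hasDerivAt_cosProfile _) (hasDerivAt_cosProfile' _) x,
    InnerProductSpace.laplacian_const]
  simp

/-- `∇ q_k = Q_k e₀`. [folklore] -/
theorem gradient_modePressure (k : ℕ) (t : ℝ) (x : ℝ³) :
    gradient (modePressure k t) x = cue k t • eZero := by
  have h : HasFDerivAt (fun y : ℝ³ => ⟪cue k t • eZero, y⟫) (innerSL ℝ (cue k t • eZero)) x :=
    (innerSL ℝ (cue k t • eZero)).hasFDerivAt
  show gradient (fun y : ℝ³ => ⟪cue k t • eZero, y⟫) x = _
  rw [gradient, h.fderiv]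
  apply (InnerProductSpace.toDual ℝ ℝ³).injective
  rw [LinearIsometryEquiv.apply_symm_apply]
  ext y
  simp [InnerProductSpace.toDual_apply_apply]

/-! ### Divergence -/

/-- A field whose derivative is that of a unidirectional shear `V(x₀) e₁` is divergence free (`tr (V' dx₀ ⊗ e₁) = V' (e₁)₀ = 0`). [folklore] -/
theorem isDivFree_shear' {V V' : ℝ → ℝ} (hV : ∀ s, HasDerivAt V (V' s) s) {f : ℝ³ → ℝ³}
    (hf : ∀ x, fderiv ℝ f x = fderiv ℝ (shear V) x) : VectorCalculus.IsDivFree f := by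
  intro x
  rw [divergence_eq_sum_inner_fderiv (EuclideanSpace.basisFun (Fin 3) ℝ), hf]
  simp only [Fin.sum_univ_three, EuclideanSpace.basisFun_apply, fderiv_shear_apply hV,
    EuclideanSpace.inner_single_left, map_one, one_mul]
  simp [eOne]

/-- `div u = 0`. [folklore] -/
theorem isDivFree_drift (t : ℝ) : VectorCalculus.IsDivFree (drift t) :=
  isDivFree_shear' (hasDerivAt_sinProfile (amp t)) fun _ => rfl

/-- `div v_k = 0`. [folklore] -/
theorem isDivFree_mode (k : ℕ) (t : ℝ) : VectorCalculus.IsDivFree (mode k t) :=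
  isDivFree_shear' (hasDerivAt_cosProfile (amp t ^ (k + 2))) fun x => by
    rw [(hasFDerivAt_mode k t x).fderiv, (hasFDerivAt_shear (hasDerivAt_cosProfile _) x).fderiv]

/-! ### The linearised momentum equation -/

/-- **The linearised momentum equation** `∂ₜv_k + (u·∇)v_k + (v_k·∇)u = Δv_k - ∇q_k` on `t < 0`: the `e₁`-component is the identity `(k+2)a^{k+3} + a B_k = -a^{k+2}`, the `e₀`-component is `B_k' = -Q_k`. [folklore] -/
theorem momentum_mode {t : ℝ} (ht : t < 0) (k : ℕ) (x : ℝ³) :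
    timeDeriv (mode k) t x + convect (drift t) (mode k t) x + convect (mode k t) (drift t) x =
      Δ (mode k t) x - gradient (modePressure k t) x := by
  rw [timeDeriv_mode ht, convect_drift_mode, convect_mode_drift, laplacian_mode,
    gradient_modePressure]
  ext i
  fin_cases i
  · simp [eOne, eZero]
  · simp [eOne, eZero, bee]
    ring
  · simp [eOne, eZero]

/-! ### Smoothness -/

/-- `(t, x) ↦ a(t)` is smooth on `t < 0`. [folklore] -/
theorem contDiffOn_amp_fst {n : WithTop ℕ∞} :
    ContDiffOn ℝ n (fun p : ℝ × ℝ³ => amp p.1) (Iio 0 ×ˢ univ) :=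
  (contDiffOn_const.sub contDiffOn_fst).inv fun _ hp => (one_sub_pos_of_neg hp.1).ne'

/-- `(t, x) ↦ x₀` is smooth. [folklore] -/
theorem contDiff_coord_zero_snd {n : WithTop ℕ∞} : ContDiff ℝ n (fun p : ℝ × ℝ³ => p.2 0) :=
  (contDiff_piLp_apply (p := 2) (i := (0 : Fin 3))).comp contDiff_snd

/-- The drift is jointly smooth on `(-∞, 0) × ℝ³`. [folklore] -/
theorem contDiffOn_drift {n : WithTop ℕ∞} :
    ContDiffOn ℝ n (uncurry drift) (Iio 0 ×ˢ univ) := by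
  have h : ContDiffOn ℝ n (fun p : ℝ × ℝ³ => (amp p.1 * Real.sin (p.2 0)) • eOne) (Iio 0 ×ˢ univ) :=
    (contDiffOn_amp_fst.mul (Real.contDiff_sin.comp contDiff_coord_zero_snd).contDiffOn).smul
      contDiffOn_const
  exact h

/-- `(t, x) ↦ B_k(t)` is smooth on `t < 0`. [folklore] -/
theorem contDiffOn_bee_fst (k : ℕ) {n : WithTop ℕ∞} :
    ContDiffOn ℝ n (fun p : ℝ × ℝ³ => bee k p.1) (Iio 0 ×ˢ univ) :=
  ((contDiffOn_const.mul (contDiffOn_amp_fst.pow _)).add (contDiffOn_amp_fst.pow _)).neg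

/-- `(t, x) ↦ Q_k(t)` is smooth on `t < 0`. [folklore] -/
theorem contDiffOn_cue_fst (k : ℕ) {n : WithTop ℕ∞} :
    ContDiffOn ℝ n (fun p : ℝ × ℝ³ => cue k p.1) (Iio 0 ×ˢ univ) :=
  (contDiffOn_const.mul (contDiffOn_amp_fst.pow _)).add
    (contDiffOn_const.mul (contDiffOn_amp_fst.pow _))

/-- The modes are jointly smooth on `(-∞, 0) × ℝ³`. [folklore] -/
theorem contDiffOn_mode (k : ℕ) {n : WithTop ℕ∞} :
    ContDiffOn ℝ n (uncurry (mode k)) (Iio 0 ×ˢ univ) := by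
  have h : ContDiffOn ℝ n
      (fun p : ℝ × ℝ³ => (amp p.1 ^ (k + 2) * Real.cos (p.2 0)) • eOne + bee k p.1 • eZero)
      (Iio 0 ×ˢ univ) :=
    (((contDiffOn_amp_fst.pow _).mul
      (Real.contDiff_cos.comp contDiff_coord_zero_snd).contDiffOn).smul contDiffOn_const).add
      ((contDiffOn_bee_fst k).smul contDiffOn_const)
  exact h

/-- The modes are jointly smooth on `(-∞, 0) × ℝ³`. [folklore] -/
theorem contDiffOn_modePressure (k : ℕ) {n : WithTop ℕ∞} :
    ContDiffOn ℝ n (uncurry (modePressure k)) (Iio 0 ×ˢ univ) := by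
  have h : ContDiffOn ℝ n (fun p : ℝ × ℝ³ => ⟪cue k p.1 • eZero, p.2⟫) (Iio 0 ×ˢ univ) :=
    ((contDiffOn_cue_fst k).smul contDiffOn_const).inner ℝ contDiffOn_snd
  exact h



end KolmogorovCex

end Summit.NavierStokesRegularity.NavierStokesRegularity.Theorems.FiniteTangentModuliMild.Negative

end
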